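import Mathlib
import Summits.ValiantsHypothesis.ValiantsHypothesis.Theorems.NewtonUnitEquationsTwoProductsFormalLogLinearisationLiftedNecessity
import Summits.ValiantsHypothesis.ValiantsHypothesis.Theorems.NewtonUnitEquationsTwoProductsFormalLogLinearisationLiftedHyperbolicCross
import Summits.ValiantsHypothesis.ValiantsHypothesis.Theorems.NewtonUnitEquationsTwoProductsFormalLogLinearisationLiftedSlotRank
import Summits.ValiantsHypothesis.ValiantsHypothesis.Theorems.NewtonUnitEquationsTwoProductsFormalLogLinearisationLiftedOverlapPencil
import Summits.ValiantsHypothesis.ValiantsHypothesis.Theorems.NewtonUnitEquationsTwoProductsPlanarCellRung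
import Summits.ValiantsHypothesis.ValiantsHypothesis.Theorems.NewtonUnitEquationsTwoProductsFormalLogLinearisationEngineCommonConeLattice
import Summits.ValiantsHypothesis.ValiantsHypothesis.Theorems.NewtonUnitEquationsTwoProductsPlanarCrossCount
import HarnessLib

/-!
# Planar rungs of line `planar_cell` (val-idea-8 g0), part B: `planarSlotBound_local` and the coincidence-charged slot bound

`planarCross_local`: for tails `u, v` (zero constant terms, ANY sparsity), an injective enumeration `E` of the tail
support, and a point `l` that is the strict `ξ`-top of `supp D` (`D = Σ log(1+u_j) − Σ log(1+v_j)`; `ξ` arbitrary —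
validity is not even needed), IF the exponent map `Λ_E` is injective on the ZONE `{μ : wt ξ l ≤ wt ξ (Λ_E μ)}` (no additive
coincidence of `E` at or above the level of `l`), THEN `l = Λ_E μ` with `∏ (μ_i + 1) ≤ 2m` — the body of `PlanarCross`
with `c = 1` (value `2m ≤ (2m)^1`).  Proof: on the zone every fibre is a singleton, so the planar log-coefficient is
`lcoef(μ)·G(μ)` with `lcoef(μ) = (−1)^{|μ|+1}(|μ|−1)!·multinomial ≠ 0` (`logDiff_eq_lifted_sum`, p586149-family), hence the
unique preimage of `l` is a strict lifted minimiser of `{G ≠ 0}` for the grading `θ_i = −wt ξ E_i`, and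
`unequalMoment_hyperbolicCross` (p591055-family) applies.  This is the DISSOCIATED calibration of the line card made
kernel-checked: SUB₁'s entire content is the behaviour AT additive coincidences.
`planarSlotBound_local` / `planarSlotBound_charged`: the SUB₂ body with value `2m` when `Λ_E` is injective on the member's zone, resp.
(sharpest form) when only the fibres the slot matrix actually reads — at each `rep d` and at each slot-shift
`(rep d ∖ slot) + e·e_{d'}`, `d' ∈ D` — are singletons.  COROLLARY (stated, immediate): for an arbitrary slot family,
`#D ≤ 2m + #{coincidence-touched members}` — the t-free content of SUB₂ is exactly `2m`; all further multiplicity is carried by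
additive coincidences of the tail support (val-lit p3 g13's ghost-pair staircase, RULING #131, touches every column: SUB₂ as a
t-free statement is FALSE, and this file says precisely what the refutation exploits).
Honest frame: rungs/structure theorems; SUB₂ REFUTED (p3), SUB₁/PlanarCellBound/crux OPEN; VP ≠ VNP not moved.
-/

set_option linter.dupNamespace false
set_option linter.unusedSectionVars false
set_option linter.style.longFile 0

noncomputable section

open scoped BigOperators
open MvPolynomial
open Summit.ValiantsHypothesis.ValiantsHypothesis.Theorems.NewtonUnitEquations.TwoProducts.FormalLogLinearisation
open Summit.ValiantsHypothesis.ValiantsHypothesis.Theorems.NewtonUnitEquations.TwoProducts.PlanarCell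

namespace Summit.ValiantsHypothesis.ValiantsHypothesis.Theorems.NewtonUnitEquations.TwoProducts.PlanarCellRungSlot

open Summit.ValiantsHypothesis.ValiantsHypothesis.Theorems.NewtonUnitEquations.TwoProducts.PlanarCellRung

variable {m : ℕ}

/-! ## Copies of the line's elementary objects (verbatim from `Lines/planar_cell.lean`, so that this rung file is
self-contained — the Lines module is a workfile, not a built import) -/

/-- **RUNG (SUB₂ below the first coincidence).**  In one cell (a relation `R` on the coordinates realised by every
member's weight), a set `D` of coordinates each carrying a representative `rep d` with slot exponent `(rep d)_d = e ≥ 1`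
whose planar image is a strict top of `supp D` for a weight `ξ_d`, such that `Λ_E` has no coincidence on the zone of
`rep d`, has `#D ≤ 2m` — the body of `PlanarSlotBound` with value `2m` (and WITHOUT needing the cross restriction or the
distinct-images clause).  Proof: the lifted slot matrix `(G(ρ_y + e·e_{d_x}))` factors through the `2m` signed terms, is
nonzero on the diagonal (visible ⇒ `G ≠ 0` on a singleton fibre) and vanishes above it (a zone point other than the top has
zero planar coefficient, and its fibre is a singleton). -/
theorem planarSlotBound_local (u v : Fin m → MvPolynomial (Fin 2) ℂ)
    (hu0 : ∀ j, coeff 0 (u j) = 0) (hv0 : ∀ j, coeff 0 (v j) = 0)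
    {s : ℕ} (E : Fin s → Expo) (hE : Function.Injective E) (hEr : Set.range E = ↑(tailSupport u v))
    (R : Fin s → Fin s → Prop) (e : ℕ) (he : 1 ≤ e) (D : Finset (Fin s)) (rep : Fin s → (Fin s → ℕ))
    (ξ : Fin s → (Fin 2 → ℝ))
    (hrep : ∀ d ∈ D, rep d d = e ∧ IsStrictTop (ξ d) (logSupport u v) (lam E (rep d)) ∧
      (∀ j j' : Fin s, R j j' ↔ wt (ξ d) (E j) ≤ wt (ξ d) (E j')) ∧
      Set.InjOn (lam E) {μ | wt (ξ d) (lam E (rep d)) ≤ wt (ξ d) (lam E μ)}) :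
    D.card ≤ 2 * m := by
  classical
  -- supports inside `range E`, and no `E i` is zero (as in `planarCross_local`)
  have hu : ∀ j, (↑(u j).support : Set Expo) ⊆ Set.range E := fun j x hx => by
    rw [hEr]
    simp only [Finset.mem_coe, tailSupport, Finset.mem_union, Finset.mem_biUnion, Finset.mem_univ, true_and]
    exact Or.inl ⟨j, hx⟩
  have hv : ∀ j, (↑(v j).support : Set Expo) ⊆ Set.range E := fun j x hx => by
    rw [hEr]
    simp only [Finset.mem_coe, tailSupport, Finset.mem_union, Finset.mem_biUnion, Finset.mem_univ, true_and]
    exact Or.inr ⟨j, hx⟩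
  have hE0 : ∀ i, E i ≠ 0 := fun i h => by
    have hi : E i ∈ (↑(tailSupport u v) : Set Expo) := by rw [← hEr]; exact ⟨i, rfl⟩
    simp only [Finset.mem_coe, tailSupport, Finset.mem_union, Finset.mem_biUnion, Finset.mem_univ, true_and,
      mem_support_iff] at hi
    rcases hi with ⟨j, hj⟩ | ⟨j, hj⟩
    · exact hj (by rw [h]; exact hu0 j)
    · exact hj (by rw [h]; exact hv0 j)
  set A : Fin m → Fin s → ℂ := fun j i => coeff (E i) (u j) with hA
  set B : Fin m → Fin s → ℂ := fun j i => coeff (E i) (v j) with hB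
  have hF := logDiff_eq_fibreSum E hE u v hu hv
  -- planar coefficient on a zone point = lcoef · G
  have hzone : ∀ d ∈ D, ∀ ν : Fin s → ℕ, ν ≠ 0 → wt (ξ d) (lam E (rep d)) ≤ wt (ξ d) (lam E ν) →
      logDiff u v (lam E ν) = lcoef ν * umom A B ν := fun d hd ν hν0 hle => by
    rw [hF (lam E ν)]
    exact fibreSum_eq_single E hE0 (fun p => wt (ξ d) (lam E (rep d)) ≤ wt (ξ d) p) (hrep d hd).2.2.2 (umom A B) ν
      hle hν0
  -- empty `D` is trivial; otherwise fix a reference member for the sort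
  rcases D.eq_empty_or_nonempty with hDe | ⟨d₀, hd₀⟩
  · simp [hDe]
  let key : Fin s → Lex (ℝ × ℕ) := fun d => toLex (-wt (ξ d₀) (E d), (d : ℕ))
  have hkey : Set.InjOn key ↑D := by
    intro d _ d' _ h
    have h2 : ((ofLex (key d)).2) = (ofLex (key d')).2 := by rw [h]
    exact Fin.ext (by simpa [key] using h2)
  set q := D.card with hq
  have hcard : (D.image key).card = q := Finset.card_image_of_injOn hkey
  let em : Fin q ↪o Lex (ℝ × ℕ) := (D.image key).orderEmbOfFin hcard
  have hem : ∀ x : Fin q, ∃ d ∈ D, key d = em x := fun x => by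
    simpa only [Finset.mem_image] using (D.image key).orderEmbOfFin_mem hcard x
  choose f hfD hfkey using hem
  have hfinj : Function.Injective f := by
    intro x y h
    have : em x = em y := by rw [← hfkey x, ← hfkey y, h]
    exact em.injective this
  have hfle : ∀ x y : Fin q, x < y → wt (ξ d₀) (E (f y)) ≤ wt (ξ d₀) (E (f x)) := by
    intro x y hxy
    have hlt : key (f x) < key (f y) := by rw [hfkey, hfkey]; exact em.strictMono hxy
    have := (Prod.Lex.toLex_lt_toLex'.1 hlt).1
    simpa [key] using this
  -- the lifted slot matrix through the `2m` signed terms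
  let c : Fin m ⊕ Fin m → ℂ := Sum.elim (fun _ => 1) (fun _ => -1)
  let a : Fin m ⊕ Fin m → Fin s → ℂ := Sum.elim A B
  set F : (Fin s → ℕ) → ℂ := fun ν => ∑ k, c k * ∏ i, a k i ^ ν i with hFdef
  have hFG : ∀ ν, F ν = umom A B ν := fun ν => expSum_elim_eq_umom A B ν
  let ρ : Fin q → (Fin s → ℕ) := fun y => Function.update (rep (f y)) (f y) 0
  let P : Matrix (Fin q) (Fin m ⊕ Fin m) ℂ := fun x k => a k (f x) ^ e
  let Q : Matrix (Fin m ⊕ Fin m) (Fin q) ℂ := fun k y => c k * ∏ i, a k i ^ ρ y i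
  have hPQ : ∀ x y, (P * Q) x y = F (ρ y + (Pi.single (f x) e : Fin s → ℕ)) := fun x y => by
    simp only [Matrix.mul_apply, P, Q, hFdef]
    rw [ExpSum.expSum_add_single]
  have hρself : ∀ y, ρ y + (Pi.single (f y) e : Fin s → ℕ) = rep (f y) := fun y => by
    have := ExpSum.update_add_single (rep (f y)) (f y)
    rw [(hrep (f y) (hfD y)).1] at this
    exact this
  have hrep0 : ∀ y, rep (f y) ≠ 0 := fun y h => by
    have := (hrep (f y) (hfD y)).1
    rw [h] at this
    simp at this
    omega
  have hbound := card_le_of_triangular_factor' P Q (fun y => ?_) (fun x y hxy => ?_)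
  · simpa [Fintype.card_sum, Fintype.card_fin, two_mul] using hbound
  · -- diagonal: the member is visible, its fibre a singleton, so `G ≠ 0`
    rw [hPQ, hρself, hFG]
    obtain ⟨-, htop, -, -⟩ := hrep (f y) (hfD y)
    have hc := hzone (f y) (hfD y) (rep (f y)) (hrep0 y) le_rfl
    intro hG
    exact htop.1 (by rw [hc, hG, mul_zero])
  · -- above the diagonal: the shifted point is in the zone, is not the top, hence has zero coefficient and `G = 0`
    rw [hPQ, hFG]
    obtain ⟨hdiag, htop, hord, hinj⟩ := hrep (f y) (hfD y)
    set pt : Fin s → ℕ := ρ y + (Pi.single (f x) e : Fin s → ℕ) with hpt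
    have hxy' : f x ≠ f y := fun h' => (hfinj h' ▸ hxy).false
    have hνne : pt ≠ rep (f y) := by
      intro h
      have h1 := congrFun h (f y)
      simp only [hpt, Pi.add_apply, ρ, Function.update_self, Pi.single_apply, hxy'.symm, if_false, add_zero] at h1
      rw [hdiag] at h1
      omega
    have hpt0 : pt ≠ 0 := fun h => by
      have h1 := congrFun h (f x)
      simp only [hpt, Pi.add_apply, Pi.single_eq_same, Pi.zero_apply] at h1
      omega
    -- weights: Λ pt = Λ ρ_y + e E_{f x},  Λ rep = Λ ρ_y + e E_{f y}
    have hw1 : wt (ξ (f y)) (lam E pt) = wt (ξ (f y)) (lam E (ρ y)) + (e : ℝ) * wt (ξ (f y)) (E (f x)) := by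
      rw [hpt, lam_add_single, wt_add, wt_nsmul]
    have hw2 : wt (ξ (f y)) (lam E (rep (f y))) = wt (ξ (f y)) (lam E (ρ y)) + (e : ℝ) * wt (ξ (f y)) (E (f y)) := by
      rw [← hρself y, lam_add_single, wt_add, wt_nsmul]
    have hle' : wt (ξ (f y)) (E (f y)) ≤ wt (ξ (f y)) (E (f x)) := by
      have h0 := hfle x y hxy
      have hR : R (f y) (f x) := ((hrep d₀ hd₀).2.2.1 _ _).2 h0
      exact (hord _ _).1 hR
    have hepos : (0 : ℝ) ≤ (e : ℝ) := by positivity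
    have hzle : wt (ξ (f y)) (lam E (rep (f y))) ≤ wt (ξ (f y)) (lam E pt) := by
      rw [hw1, hw2]
      nlinarith [mul_le_mul_of_nonneg_left hle' hepos]
    have hself : rep (f y) ∈ {μ | wt (ξ (f y)) (lam E (rep (f y))) ≤ wt (ξ (f y)) (lam E μ)} := by
      simp only [Set.mem_setOf_eq]; exact le_rfl
    have hne' : lam E pt ≠ lam E (rep (f y)) := fun h => hνne (hinj hzle hself h)
    have hnot : lam E pt ∉ logSupport u v := fun hmem => absurd (htop.2 _ hmem hne') (not_lt.mpr hzle)
    have hzero : logDiff u v (lam E pt) = 0 := by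
      by_contra h
      exact hnot h
    have hc := hzone (f y) (hfD y) pt hpt0 hzle
    rw [hzero] at hc
    exact (mul_eq_zero.mp hc.symm).resolve_left (lcoef_ne_zero pt hpt0)


/-- **COINCIDENCE-CHARGED SLOT BOUND (the exact t-free part of SUB₂).**  Same setting as `planarSlotBound_local`, but the
additive-coincidence hypothesis is only imposed WHERE THE SLOT MATRIX LOOKS: every member `d ∈ D` has a singleton fibre at its
own representative `rep d`, and at each shifted point `(rep d with slot d emptied) + e·e_{d'}` for `d' ∈ D`.  Then `#D ≤ 2m`.
Consequently, for an ARBITRARY slot family `D₀` (hypotheses of `PlanarSlotBound`), `#D₀ ≤ 2m + #{d ∈ D₀ : some slot-shift of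
rep d, or rep d itself, has a non-singleton fibre}` (apply this theorem to the good sub-family): the t-free content of SUB₂ is
exactly `2m`, and ALL multiplicity beyond it is carried by coordinates touched by an additive coincidence of the tail support —
in val-lit p3 g13's staircase (RULING #131) every column is touched by a ghost pair `f_i + f'_j ∈ E`, so the bound is vacuous
there, as it must be. -/
theorem planarSlotBound_charged (u v : Fin m → MvPolynomial (Fin 2) ℂ)
    (hu0 : ∀ j, coeff 0 (u j) = 0) (hv0 : ∀ j, coeff 0 (v j) = 0)
    {s : ℕ} (E : Fin s → Expo) (hE : Function.Injective E) (hEr : Set.range E = ↑(tailSupport u v))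
    (R : Fin s → Fin s → Prop) (e : ℕ) (he : 1 ≤ e) (D : Finset (Fin s)) (rep : Fin s → (Fin s → ℕ))
    (ξ : Fin s → (Fin 2 → ℝ))
    (hrep : ∀ d ∈ D, rep d d = e ∧ IsStrictTop (ξ d) (logSupport u v) (lam E (rep d)) ∧
      (∀ j j' : Fin s, R j j' ↔ wt (ξ d) (E j) ≤ wt (ξ d) (E j')) ∧
      (∀ k : Fin s → ℕ, lam E k = lam E (rep d) → k = rep d) ∧
      (∀ d' ∈ D, ∀ k : Fin s → ℕ,
        lam E k = lam E (Function.update (rep d) d 0 + (Pi.single d' e : Fin s → ℕ)) →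
          k = Function.update (rep d) d 0 + (Pi.single d' e : Fin s → ℕ))) :
    D.card ≤ 2 * m := by
  classical
  have hu : ∀ j, (↑(u j).support : Set Expo) ⊆ Set.range E := fun j x hx => by
    rw [hEr]
    simp only [Finset.mem_coe, tailSupport, Finset.mem_union, Finset.mem_biUnion, Finset.mem_univ, true_and]
    exact Or.inl ⟨j, hx⟩
  have hv : ∀ j, (↑(v j).support : Set Expo) ⊆ Set.range E := fun j x hx => by
    rw [hEr]
    simp only [Finset.mem_coe, tailSupport, Finset.mem_union, Finset.mem_biUnion, Finset.mem_univ, true_and]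
    exact Or.inr ⟨j, hx⟩
  have hE0 : ∀ i, E i ≠ 0 := fun i h => by
    have hi : E i ∈ (↑(tailSupport u v) : Set Expo) := by rw [← hEr]; exact ⟨i, rfl⟩
    simp only [Finset.mem_coe, tailSupport, Finset.mem_union, Finset.mem_biUnion, Finset.mem_univ, true_and,
      mem_support_iff] at hi
    rcases hi with ⟨j, hj⟩ | ⟨j, hj⟩
    · exact hj (by rw [h]; exact hu0 j)
    · exact hj (by rw [h]; exact hv0 j)
  set A : Fin m → Fin s → ℂ := fun j i => coeff (E i) (u j) with hA
  set B : Fin m → Fin s → ℂ := fun j i => coeff (E i) (v j) with hB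
  have hF := logDiff_eq_fibreSum E hE u v hu hv
  -- planar coefficient at a singleton-fibre point = lcoef · G
  have hsingle : ∀ ν : Fin s → ℕ, ν ≠ 0 → (∀ k, lam E k = lam E ν → k = ν) →
      logDiff u v (lam E ν) = lcoef ν * umom A B ν := fun ν hν0 hfib => by
    rw [hF (lam E ν)]
    exact fibreSum_eq_single' E hE0 (umom A B) ν hfib hν0
  rcases D.eq_empty_or_nonempty with hDe | ⟨d₀, hd₀⟩
  · simp [hDe]
  let key : Fin s → Lex (ℝ × ℕ) := fun d => toLex (-wt (ξ d₀) (E d), (d : ℕ))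
  have hkey : Set.InjOn key ↑D := by
    intro d _ d' _ h
    have h2 : ((ofLex (key d)).2) = (ofLex (key d')).2 := by rw [h]
    exact Fin.ext (by simpa [key] using h2)
  set q := D.card with hq
  have hcard : (D.image key).card = q := Finset.card_image_of_injOn hkey
  let em : Fin q ↪o Lex (ℝ × ℕ) := (D.image key).orderEmbOfFin hcard
  have hem : ∀ x : Fin q, ∃ d ∈ D, key d = em x := fun x => by
    simpa only [Finset.mem_image] using (D.image key).orderEmbOfFin_mem hcard x
  choose f hfD hfkey using hem
  have hfinj : Function.Injective f := by
    intro x y h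
    have : em x = em y := by rw [← hfkey x, ← hfkey y, h]
    exact em.injective this
  have hfle : ∀ x y : Fin q, x < y → wt (ξ d₀) (E (f y)) ≤ wt (ξ d₀) (E (f x)) := by
    intro x y hxy
    have hlt : key (f x) < key (f y) := by rw [hfkey, hfkey]; exact em.strictMono hxy
    have := (Prod.Lex.toLex_lt_toLex'.1 hlt).1
    simpa [key] using this
  let c : Fin m ⊕ Fin m → ℂ := Sum.elim (fun _ => 1) (fun _ => -1)
  let a : Fin m ⊕ Fin m → Fin s → ℂ := Sum.elim A B
  set F : (Fin s → ℕ) → ℂ := fun ν => ∑ k, c k * ∏ i, a k i ^ ν i with hFdef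
  have hFG : ∀ ν, F ν = umom A B ν := fun ν => expSum_elim_eq_umom A B ν
  let ρ : Fin q → (Fin s → ℕ) := fun y => Function.update (rep (f y)) (f y) 0
  let P : Matrix (Fin q) (Fin m ⊕ Fin m) ℂ := fun x k => a k (f x) ^ e
  let Q : Matrix (Fin m ⊕ Fin m) (Fin q) ℂ := fun k y => c k * ∏ i, a k i ^ ρ y i
  have hPQ : ∀ x y, (P * Q) x y = F (ρ y + (Pi.single (f x) e : Fin s → ℕ)) := fun x y => by
    simp only [Matrix.mul_apply, P, Q, hFdef]
    rw [ExpSum.expSum_add_single]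
  have hρself : ∀ y, ρ y + (Pi.single (f y) e : Fin s → ℕ) = rep (f y) := fun y => by
    have := ExpSum.update_add_single (rep (f y)) (f y)
    rw [(hrep (f y) (hfD y)).1] at this
    exact this
  have hrep0 : ∀ y, rep (f y) ≠ 0 := fun y h => by
    have := (hrep (f y) (hfD y)).1
    rw [h] at this
    simp at this
    omega
  have hbound := card_le_of_triangular_factor' P Q (fun y => ?_) (fun x y hxy => ?_)
  · simpa [Fintype.card_sum, Fintype.card_fin, two_mul] using hbound
  · rw [hPQ, hρself, hFG]
    obtain ⟨-, htop, -, hfib, -⟩ := hrep (f y) (hfD y)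
    have hc := hsingle (rep (f y)) (hrep0 y) hfib
    intro hG
    exact htop.1 (by rw [hc, hG, mul_zero])
  · rw [hPQ, hFG]
    obtain ⟨hdiag, htop, hord, -, hshift⟩ := hrep (f y) (hfD y)
    set pt : Fin s → ℕ := ρ y + (Pi.single (f x) e : Fin s → ℕ) with hpt
    have hxy' : f x ≠ f y := fun h' => (hfinj h' ▸ hxy).false
    have hνne : pt ≠ rep (f y) := by
      intro h
      have h1 := congrFun h (f y)
      simp only [hpt, Pi.add_apply, ρ, Function.update_self, Pi.single_apply, hxy'.symm, if_false, add_zero] at h1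
      rw [hdiag] at h1
      omega
    have hpt0 : pt ≠ 0 := fun h => by
      have h1 := congrFun h (f x)
      simp only [hpt, Pi.add_apply, Pi.single_eq_same, Pi.zero_apply] at h1
      omega
    have hw1 : wt (ξ (f y)) (lam E pt) = wt (ξ (f y)) (lam E (ρ y)) + (e : ℝ) * wt (ξ (f y)) (E (f x)) := by
      rw [hpt, lam_add_single, wt_add, wt_nsmul]
    have hw2 : wt (ξ (f y)) (lam E (rep (f y))) = wt (ξ (f y)) (lam E (ρ y)) + (e : ℝ) * wt (ξ (f y)) (E (f y)) := by
      rw [← hρself y, lam_add_single, wt_add, wt_nsmul]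
    have hle' : wt (ξ (f y)) (E (f y)) ≤ wt (ξ (f y)) (E (f x)) := by
      have h0 := hfle x y hxy
      have hR : R (f y) (f x) := ((hrep d₀ hd₀).2.2.1 _ _).2 h0
      exact (hord _ _).1 hR
    have hepos : (0 : ℝ) ≤ (e : ℝ) := by positivity
    have hzle : wt (ξ (f y)) (lam E (rep (f y))) ≤ wt (ξ (f y)) (lam E pt) := by
      rw [hw1, hw2]
      nlinarith [mul_le_mul_of_nonneg_left hle' hepos]
    have hfibpt : ∀ k, lam E k = lam E pt → k = pt := hshift (f x) (hfD x)
    have hne' : lam E pt ≠ lam E (rep (f y)) := fun h => hνne (by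
      obtain ⟨-, -, -, hfib, -⟩ := hrep (f y) (hfD y)
      exact (hfib pt h))
    have hnot : lam E pt ∉ logSupport u v := fun hmem => absurd (htop.2 _ hmem hne') (not_lt.mpr hzle)
    have hzero : logDiff u v (lam E pt) = 0 := by
      by_contra h
      exact hnot h
    have hc := hsingle pt hpt0 hfibpt
    rw [hzero] at hc
    exact (mul_eq_zero.mp hc.symm).resolve_left (lcoef_ne_zero pt hpt0)


/-- **COROLLARY (the counting form used by crux idea `coincidence-dichotomy`).**  For ANY slot family in a cell and any
set `T ⊆ D` containing every coincidence-TOUCHED member (i.e. every member outside `T` has singleton fibres at its representative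
and at all its slot shifts towards members of `D`), `#D ≤ 2m + #T`: the `t`-free part of the dead SUB₂ is exactly `2m`, and all
further multiplicity is charged to additive coincidences of the tail support. -/
theorem card_le_two_mul_add_card_touched (u v : Fin m → MvPolynomial (Fin 2) ℂ)
    (hu0 : ∀ j, coeff 0 (u j) = 0) (hv0 : ∀ j, coeff 0 (v j) = 0)
    {s : ℕ} (E : Fin s → Expo) (hE : Function.Injective E) (hEr : Set.range E = ↑(tailSupport u v))
    (R : Fin s → Fin s → Prop) (e : ℕ) (he : 1 ≤ e) (D T : Finset (Fin s)) (hTD : T ⊆ D)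
    (rep : Fin s → (Fin s → ℕ)) (ξ : Fin s → (Fin 2 → ℝ))
    (hrep : ∀ d ∈ D, rep d d = e ∧ IsStrictTop (ξ d) (logSupport u v) (lam E (rep d)) ∧
      (∀ j j' : Fin s, R j j' ↔ wt (ξ d) (E j) ≤ wt (ξ d) (E j')))
    (huntouched : ∀ d ∈ D, d ∉ T →
      (∀ k : Fin s → ℕ, lam E k = lam E (rep d) → k = rep d) ∧
      (∀ d' ∈ D, ∀ k : Fin s → ℕ,
        lam E k = lam E (Function.update (rep d) d 0 + (Pi.single d' e : Fin s → ℕ)) →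
          k = Function.update (rep d) d 0 + (Pi.single d' e : Fin s → ℕ))) :
    D.card ≤ 2 * m + T.card := by
  classical
  have h0 : (D \ T).card ≤ 2 * m := by
    refine planarSlotBound_charged u v hu0 hv0 E hE hEr R e he (D \ T) rep ξ ?_
    intro d hd
    rw [Finset.mem_sdiff] at hd
    obtain ⟨h1, h2, h3⟩ := hrep d hd.1
    obtain ⟨hg1, hg2⟩ := huntouched d hd.1 hd.2
    refine ⟨h1, h2, h3, hg1, ?_⟩
    intro d' hd' k hk
    exact hg2 d' (Finset.mem_sdiff.mp hd').1 k hk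
  have hsplit := Finset.card_sdiff_add_card_eq_card hTD
  omega

end Summit.ValiantsHypothesis.ValiantsHypothesis.Theorems.NewtonUnitEquations.TwoProducts.PlanarCellRungSlot

end
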